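import Literature.MathematicalPhysics.QuantumFieldTheory.Balaban1983to89.B9B8KnitLandauTransfer
import Literature.MathematicalPhysics.QuantumFieldTheory.Balaban1983to89.B9B8KnitLetterRealityLeftInv
import Literature.MathematicalPhysics.QuantumFieldTheory.Balaban1983to89.B9Thm311DeltaPrimeSymm
import Literature.MathematicalPhysics.QuantumFieldTheory.Balaban1983to89.B9B8KnitLetterPeriodic
import Literature.MathematicalPhysics.QuantumFieldTheory.Balaban1983to89.B9Eq321LandauProjectionZdPer

/-!
# `Balaban1983to89.B9B8KnitLandauProjection` — [Balaban1985BackgroundPropagators] (3.21) = (3.25) ON THE TORUS, ACROSS THE TWO LINEAGES: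
# dag-n06's periodic ORTHOGONAL PROJECTION `R(U₀)` onto `Δ^η_{U₀}N_𝔤^per(Q′(U₀))` (`B9Eq321LandauProjectionZdPer.projRPer`, print (3.21)–(3.22))
# IS def-Y's Lagrange-multiplier letter `RY = I − G′Q′*(Q′G′²Q′*)⁻¹Q′G′` (`Node00.OpsYDeltaA.RY`, print (3.25)) at the torus datum of the knit
# — the (B)-line bond junction, file 4 (the LANDAU SECTOR of the Neumann junction, lit-balaban RULING #10)

statement-level skeleton of published theorems with citation tags; proofs where landed; nothing here is a claim about the
Yang–Mills mass gap

`[Balaban1985BackgroundPropagators]` ("B9" = [4] of B8, CMP **99** (1985) 389–434) p. 394: *«R = R(U) is an orthogonal projection in the Hilbert space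
L²(Ω₀, 𝔤) onto the subspace ℛ = Δ^η_U N(Q′), N(Q′) = {λ : Q′λ = 0}. (3.21) For an arbitrary function f ∈ L²(Ω₀, 𝔤) we have Rf = Δ^η_U λ₀, where λ₀ is a
minimum of the function λ ∈ N(Q′), λ → ‖f − Δ^η_U λ‖². (3.22) … Using the Lagrange multipliers method the minimum of (3.22) can be found by the same
calculations as in [4], (2.15)–(2.17), and we obtain the formula Rf = (I − G′Q′*(Q′G′²Q′*)⁻¹Q′G′)f, (3.25) where G′ = G′(U) = (Δ′_a)⁻¹.»*; p. 392: *«The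
adjoints are taken with respect to natural L² scalar products for functions with values in N × N hermitian matrices. The inner product for these
matrices is defined by X·Y = tr XY.»*; (3.24) p. 394 (`Δ′_a = Δ^η_U + Q′*aQ′`).  `[Balaban1985RegularSpaces]` (B8, CMP **99** 75–102) p. 77 («Ω_j = T_η»),
(1.58) p. 86.  Pages held: `paper:balaban1985-cmp99-background-propagators` pp. 394–400 (this seat; p. 394 re-read on the text layer 2026-08-28).

WHY THIS FILE (sub-row G-B8-T2S, unit `lit-balaban-t2s-1` gen 6; lit-balaban RULING #10 (lead g32, 2026-08-28): the G-side junction road of record is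
the NEUMANN junction `Δ_knit = Δ_Y♯ − E` on the periodic Hermitian bond fields, whose EXACT sectors are `D*D` (file 1 `B9B8KnitBondTransfer`) and the
LANDAU sector — this file).  The two lineages type (3.20)–(3.25) independently: dag-n06 (pub-ymgap, `B9Eq321LandauProjectionZdPer`) as the orthogonal
projection `projEPer ∕ projRPer τ P L m η Λs U₀` for the torus pairing `formPer τ P = Σ_{x∈[0,P)^{d+1}} Re τ(f(x)* g(x))` onto the real span of
`{Δ^η_{U₀}λ : λ ∈ N_𝔤^per(Q′(U₀))}` (print (3.21)); def-Y (Node 00, `OpsYDeltaA`) as the formula (3.25).  Print asserts they are the same operator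
(the Lagrange-multiplier sentence).  THIS FILE PROVES IT at the torus datum of the knit: at p33's transporters `parKnitY` (J-B), `G′ := GpY parKnitY`,
`U := bgY U₀` for an `N₀`-periodic `G`-valued `U₀` (`G ≤ U(N)`), `τ = tr`, on `N₀`-periodic Hermitian-valued site functions.

THE ARGUMENT (print's, made explicit).  (i) RANGE: `Rf = Δ′_aλ₀` with `λ₀ = G′f − G′²Q′*μ`, `μ = (Q′G′²Q′*)⁻¹Q′G′f`, and `Q′λ₀ = Q′G′f − XX⁻¹Q′G′f = 0`
(§1, any algebra `𝔸`, any transporters; only `Δ′_aG′ = 1` and `XX⁻¹ = 1`); on `N(Q′)` the averaging term of (3.24) drops, so `Δ′_aλ₀ = Δ_Uλ₀` (§2, at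
`parKnitY`, by J-B's `avgTerm_parKnitY_eq` ∕ `QpY_parKnitY_eq_QprimeIter`), and the knit's average of `λ₀♯` vanishes at EVERY label of `ℤ^{d+1}` (§2,
J-B file 4a's periodicity `QprimeIter_periodic`) — so `(Rf)♯ = η²·Δ^η_{U₀}λ₀♯` is a generator of the range, `λ₀♯` Hermitian by def-Y's reality calculus
(`Node00.OpsYSectDReal`, §3).  (ii) ORTHOGONALITY: `f − Rf = G′Q′*μ` and, for `λ ∈ N(Q′)`, `⟨Δ_Uλ, G′Q′*μ⟩ = ⟨Δ′_aλ, G′Q′*μ⟩ = ⟨λ, Δ′_aG′Q′*μ⟩ = ⟨λ, Q′*μ⟩ =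
⟨Q′λ, μ⟩_𝔅 = 0` by the SYMMETRY of `Δ′_a(U; parKnitY)` (n06-j `B9Thm311DeltaPrimeSymm.deltaPrimeAY_isSymmTr_of_inv_symm` + J-B `parKnitY_inv`), `Δ′_aG′ = 1`,
and «Q′* is the adjoint of Q′» (n06-j `B9Thm311AdjointAtLetters.isAdjTr_QpY_QpsY`) (§3, `𝔸 = M_N(ℂ)`).  (iii) dag-n06's projection is CHARACTERISED by
(i)–(ii) (`projEPer_apply_of_mem_range ∕ _of_mem_orthogonal`, complement by `isCompl_rangeSubPer_orthogonal`), once the period-cell sum is read on the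
box (`sum_box_eq_sum_siteY`) and `formPer tr` is the trace pairing `trIP 1` of the row-17 files (`formPer_eq_trIP`) (§4).

WHAT IS PROVED (kernel, 0 sorry, theorems only; every hypothesis displayed).
* §1 (any `𝔸`, any `parS`): ★ `RY_apply_eq_deltaPrimeAY` (`Rf = Δ′_aλ₀`, needs `IsUnit Δ′_a`), ★ `QpY_lagrange_eq_zero` (`Q′λ₀ = 0`, needs `IsUnit (Q′G′²Q′*)`),
  `sub_RY_apply` (`f − Rf = G′Q′*μ`).
* §2 (any `𝔸`, `parS := parKnitY`): `conjR_zero`, `QprimeIter_liftL_at_blk_eq_zero`, ★★ `deltaPrimeAY_parKnitY_apply_of_QpY_eq_zero` ∕ `…_eq_lapS_of_QpY_eq_zero`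
  («`Q′λ = 0 ⟹ Δ′_aλ = Δ_Uλ`»), `blk_smul_self`, `blk_add_period`, ★★ `QprimeIter_liftL_eq_zero` (constant level `n`: `Q′(U)Λ = 0 ⟹` the knit's level-`n`
  average of `Λ♯` vanishes at every label).
* §3 (`𝔸 = M_N(ℂ)`, `G`-valued data, `G ≤ U(N)`): `trIP_zero_left`, ★★ `trIP_lapS_sub_RY_eq_zero` (`⟨Δ_Uλ, f − Rf⟩₁ = 0` for `Q′λ = 0`), ★ `isSelfAdjoint_RY_apply`, ★ `isSelfAdjoint_lagrange_apply` (Hermitian in, Hermitian out — def-Y's `RY_isRealOpY` etc. by name).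
* §4 (`𝔸 = M_N(ℂ)`, `letI : CStarAlgebra (Matrix (Fin N) (Fin N) ℂ) := {}` as in r05's B-LINE A): `apply_add_period_of_isPeriodic`, `shiftCfg_eq_of_isPeriodic`,
  `transl_add_period_smul`, ★ `liftL_isPeriodic` (dag-n06's full-lattice `IsPeriodic N₀ (Φ♯)`), `siteAt_val_of_mem_box`, `val_mem_box`, ★ `sum_box_eq_sum_siteY`
  (`Σ_{x∈[0,N₀)^{d+1}} F x = Σ_{z ∈ box} F z`), `trace_hermitian`, `trace_faithful` (`τ = tr` satisfies dag-n06's `hτs ∕ hτp`), ★ `formPer_eq_trIP`,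
  `trIP_real_smul_left`, ★★★ **`projRPer_eq_liftL_RY`** — for `N₀`-periodic Hermitian `f`:
  `projRPer τ N₀ L n η (torusLam n) U₀ f = (RY i parKnitY (GpY parKnitY) (bgY U₀) f♭)♯`.

HYPOTHESES OF THE MAIN THEOREM (all displayed; the shapes of the knit files): constant level `∀ z, levY i z = n`; `G ≤ unitaryUnits`; `U₀ x μ ∈ G`;
`IsPeriodic N₀ U₀`; `G`-valued knit legs `parKnitY i (bgY i U₀) z w ∈ G` (p33's `knit_E1` hypothesis; supplied on 𝔄 by `B9B8KnitLetterCoercive`);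
`IsUnit (deltaPrimeAY i parKnitY (bgY U₀))` and `IsUnit (XY i parKnitY (GpY parKnitY) (bgY U₀))` (Thm 3.1∕3.2's regime, file 2's hypotheses); `η ≠ 0`;
`τ a = tr a`; `IsPeriodic N₀ f`; `∀ x, IsSelfAdjoint (f x)`.

HONEST SCOPE.  Finite-dimensional linear algebra and bookkeeping across two typings of the same printed object; the analytic content of [4] (Thm 3.1,
3.2, 3.11: invertibility and bounds) is NOT proved here — it enters as the two `IsUnit` hypotheses; the Hermitian restriction is print's («functions with
values in N × N hermitian matrices»).  OUR READINGS: `τ = tr`; the knit's transporters are p33's `parKnitY`; the constant-level members are the sub-row's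
catalogue members `mem P₀ n`.  Count-neutral: `B9P3PerAt` ∕ `B9P3ThreeAt` ∕ `SockB9P3(Per)` ∕ `stub_PV3A` NOT discharged; nothing continuum ∕ ℝ⁴ ∕ OS ∕
mass gap ∕ Clay — the Yang–Mills mass gap is NOT proved by any of this (Track A conditional rung).  No `sorry`, no `def`, no `… : Prop` fact, no
`instance`, no `notation`.  NEW file; nothing landed is modified; dag-n06 (`B9Eq321LandauProjectionZdPer`), n06-j (`B9Thm311DeltaPrimeSymm`,
`B9Thm311AdjointAtLetters`), def-Y (`Node00.OpsYSectDReal`), p33 (J-B `B9B8AveragingJunction` ∕ `B9B8DeltaPrimeJunction` ∕ `B9B8KnitLetterPeriodic` ∕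
`B9B8KnitLetterRealityLeftInv`, A1 `B9B8KnitLetterTransfer`) and this seat's files 1–3 are used BY NAME.
-/

noncomputable section

namespace Literature.MathematicalPhysics.QuantumFieldTheory.Balaban1983to89.B9B8KnitLandauProjection

open scoped BigOperators
open Node00
open B7Prop1Explicit renaming Site → LSite
open B7Prop1Explicit (e)
open B7Eq78Linearization (QprimeIter zdBlocking)
open B8Eq119TwistedAxial (bgT)
open B8Eq138LandauZd (covLap QprimeT)
open B8Thm4TorusAt (torusLam)
open B12Ineq417Flat (shiftCfg)
open B6KLevelCensusIndexV1 (KIdx)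
open B6GlobalChartV1 (PV boxEquiv)
open B6Geom246MultiLevelBox (blkOf blkOf_eq_iff_blk)
open B4Reflection242 (blk)
open Literature.MathematicalPhysics.QuantumLattice (blockMap)
open B9B8CarrierDictionary (liftFun liftCfg)
open B9B8KnitLetterTransfer (siteAt siteAt_of_mem siteAt_val_apply liftL liftL_eq liftL_apply liftL_apply_val descL descL_apply liftL_descL
  descL_liftL blk_level)
open B9B8AveragingJunction (parKnitY parKnitY_inv QpY_parKnitY_eq_QprimeIter blockMap_iterate blk_eq_blockMap levY_of_blkOf)
open B9B8DeltaPrimeJunction (avgTerm_parKnitY_eq QprimeT_eq_compT)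
open B9B8KnitLandauTransfer (lapS_eq_covLap_liftL)
open B8Thm2TorusLettersPerOfKnit (bgY liftCfg_bgY bgY_mem)
open B9Thm311ReadingCoords (trIP IsSymmTr IsAdjTr trIP_eq_re_trace)
open B9Thm311AdjointAtLetters (isAdjTr_QpY_QpsY)
open B9Thm311ReadingAtLetters (wB)
open B9Thm311DeltaPrimeSymm (deltaPrimeAY_isSymmTr_of_inv_symm)
open B9B8KnitLetterRealityLeftInv (isSelfAdjoint_apply_of_isRealOpY mem_unitary_of_mem parKnitY_mem_unitary GpY_parKnitY_isRealOpY)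
open B9B8KnitLetterPeriodic (qLev period_eq_pow_mul QprimeIter_periodic covLap_periodic periodic_eq_at_chart constLev_le)
open B9B8CarrierDictionary (shiftCfg_liftFun liftCfg_periodic)

variable {d ℓ : ℕ} {hd : 1 ≤ d + 1} {hL : Odd (ℓ + 1) ∧ 1 < ℓ + 1} {b₀ b₁ : ℝ}

/-! ## §1 The Lagrange-multiplier form of `R(U)`: `R f = Δ′_a λ₀` with `Q′λ₀ = 0`, and `f − R f = G′Q′*μ` -/

section Range

variable {𝔸 : Type} [NormedRing 𝔸] [NormedAlgebra ℂ 𝔸] [CompleteSpace 𝔸]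
variable (i : KIdx d ℓ hd hL b₀ b₁) (parS : SiteParY 𝔸 i) (U : CfgY 𝔸 i)

/-- ★ **(3.25) ⟹ (3.22)'s MINIMISER**: `R(U)f = Δ′_a(U)λ₀` with `λ₀ = G′f − G′²Q′*μ`, `μ = (Q′G′²Q′*)⁻¹Q′G′f` (wherever `Δ′_a(U)` is invertible).
[cite: Balaban1985BackgroundPropagators, (3.22), (3.25) pp.394–395 («Using the Lagrange multipliers method …»)] -/
theorem RY_apply_eq_deltaPrimeAY (hΔ : IsUnit (deltaPrimeAY i parS U)) (f : SiteY i → 𝔸) :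
    RY i parS (GpY i parS) U f =
      deltaPrimeAY i parS U
        (GpY i parS U f -
          GpY i parS U (GpY i parS U (QpsY i parS U
            (XinvY i parS (GpY i parS) U (QpY i parS U (GpY i parS U f)))))) := by
  have hΔG : ∀ v : SiteY i → 𝔸, deltaPrimeAY i parS U (GpY i parS U v) = v := fun v => by
    have h := congrArg (fun T : Module.End ℂ (SiteY i → 𝔸) => T v) (deltaPrimeAY_mul_GpY i parS U hΔ)
    simpa only [Module.End.mul_apply, Module.End.one_apply] using h
  rw [map_sub, hΔG, hΔG]
  rfl

/-- ★ the minimiser satisfies the constraint: `Q′(U)λ₀ = 0` (wherever `Q′G′²Q′*` is invertible). [cite: Balaban1985BackgroundPropagators, (3.21)–(3.22) p.394] -/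
theorem QpY_lagrange_eq_zero (hX : IsUnit (XY i parS (GpY i parS) U)) (f : SiteY i → 𝔸) :
    QpY i parS U
        (GpY i parS U f -
          GpY i parS U (GpY i parS U (QpsY i parS U
            (XinvY i parS (GpY i parS) U (QpY i parS U (GpY i parS U f)))))) = 0 := by
  have hXX : ∀ v : BlkY i → 𝔸, XY i parS (GpY i parS) U (XinvY i parS (GpY i parS) U v) = v := fun v => by
    have h := congrArg (fun T : Module.End ℂ (BlkY i → 𝔸) => T v) (Ring.mul_inverse_cancel _ hX)
    simpa only [XinvY, Module.End.mul_apply, Module.End.one_apply] using h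
  have hXap : ∀ w : BlkY i → 𝔸, XY i parS (GpY i parS) U w = QpY i parS U (GpY i parS U (GpY i parS U (QpsY i parS U w))) :=
    fun w => rfl
  rw [map_sub, ← hXap, hXX, sub_self]

/-- `f − R(U)f = G′Q′*μ` (unfolding (3.25)). [cite: Balaban1985BackgroundPropagators, (3.25) p.395] -/
theorem sub_RY_apply (f : SiteY i → 𝔸) :
    f - RY i parS (GpY i parS) U f =
      GpY i parS U (QpsY i parS U (XinvY i parS (GpY i parS) U (QpY i parS U (GpY i parS U f)))) := by
  show f - (f - _) = _
  rw [sub_sub_cancel]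
  rfl

end Range

/-! ## §2 At the knit's transporters `parKnitY`: `Q′λ = 0 ⟹ Δ′_a λ = Δ_U λ` (the averaging term drops) -/

section Knit

variable {𝔸 : Type} [NormedRing 𝔸] [NormedAlgebra ℂ 𝔸] [CompleteSpace 𝔸]
variable (i : KIdx d ℓ hd hL b₀ b₁) {n : ℕ}

omit [NormedAlgebra ℂ 𝔸] [CompleteSpace 𝔸] in
/-- conjugation of `0` is `0`. [cite: Balaban1985Averaging, (17) p.19, bookkeeping] -/
theorem conjR_zero (X : 𝔸ˣ) : B7Eq78Linearization.conjR X (0 : 𝔸) = 0 := by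
  simp [B7Eq78Linearization.conjR]

/-- ★ the knit's level-`n` average of the periodic lift of a box function `Λ` with `Q′(U)Λ = 0` VANISHES at the label of every box point's block.
[cite: Balaban1985BackgroundPropagators, (3.19) p.393, (3.21) p.394] -/
theorem QprimeIter_liftL_at_blk_eq_zero (U : CfgY 𝔸 i) {Λ : SiteY i → 𝔸} (hΛ : QpY i (parKnitY i) U Λ = 0) (z : SiteY i) :
    QprimeIter (zdBlocking (d + 1) (ℓ + 1)) (bgT (ℓ + 1) (liftCfg U)) (levY i z) (liftL i Λ) (blk ((ℓ + 1) ^ levY i z) z.1) = 0 := by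
  have hlv : levY i z = (blkOf i.D.toDomains z).1.1 := levY_of_blkOf i rfl
  have hlab : blk ((ℓ + 1) ^ (blkOf i.D.toDomains z).1.1) z.1 = (blkOf i.D.toDomains z).1.2 :=
    (blkOf_eq_iff_blk i.D.toDomains).1 rfl
  rw [hlv, hlab, liftL_eq, ← QpY_parKnitY_eq_QprimeIter i U Λ (blkOf i.D.toDomains z), hΛ]
  rfl

/-- ★★ **`Q′(U)λ = 0 ⟹ Δ′_a(U)λ = Δ_U λ`** at the knit's transporters: on the null space of the averaging the operator (3.24) IS the covariant
Laplacian (3.23) — the identity behind «R = Δ^η_U N(Q′)» of (3.21) read with `Δ′_a` («the functions λ in (3.22) … Δ′_a = Δ + Q′*aQ′»).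
[cite: Balaban1985BackgroundPropagators, (3.21)–(3.24) p.394] -/
theorem deltaPrimeAY_parKnitY_apply_of_QpY_eq_zero (U : CfgY 𝔸 i) {Λ : SiteY i → 𝔸} (hΛ : QpY i (parKnitY i) U Λ = 0) (z : SiteY i) :
    deltaPrimeAY i (parKnitY i) U Λ z = lapS i U Λ z := by
  rw [← sub_eq_zero, B9B8DeltaPrimeJunction.deltaPrimeAY_sub_lapS, avgTerm_parKnitY_eq, QprimeT_eq_compT, blockMap_iterate,
    ← blk_eq_blockMap, ← liftL_eq, QprimeIter_liftL_at_blk_eq_zero i U hΛ z, conjR_zero, smul_zero, smul_zero]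

/-- the same as functions. [cite: Balaban1985BackgroundPropagators, (3.21)–(3.24) p.394] -/
theorem deltaPrimeAY_parKnitY_eq_lapS_of_QpY_eq_zero (U : CfgY 𝔸 i) {Λ : SiteY i → 𝔸} (hΛ : QpY i (parKnitY i) U Λ = 0) :
    deltaPrimeAY i (parKnitY i) U Λ = lapS i U Λ :=
  funext fun z => deltaPrimeAY_parKnitY_apply_of_QpY_eq_zero i U hΛ z

/-- `blk b (b • y) = y`: the label of the scaled point. [cite: Balaban1984PropagatorsII, (2.3) p.224, bookkeeping] -/
theorem blk_smul_self {b : ℕ} (hb : 1 ≤ b) (y : LSite (d + 1)) : blk b (((b : ℕ) : ℤ) • y) = y := by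
  funext μ
  have hb0 : ((b : ℕ) : ℤ) ≠ 0 := by exact_mod_cast (Nat.one_le_iff_ne_zero.1 hb)
  simp only [blk, Pi.smul_apply, smul_eq_mul]
  exact Int.mul_ediv_cancel_left _ hb0

/-- a period shift of a fine point shifts its level-`j` label by the coarse period `q_j = N₀ ∕ Lʲ`. [cite: Balaban1985RegularSpaces, (1.29) p.81, p.77, bookkeeping] -/
theorem blk_add_period {j : ℕ} (hj : j ≤ i.k) (x : LSite (d + 1)) (μ : Fin (d + 1)) :
    blk ((ℓ + 1) ^ j) (x + (((PV d ℓ i.m i.K hd hL).sitesPerDir 0 : ℕ) : ℤ) • e μ) = blk ((ℓ + 1) ^ j) x + ((qLev i j μ : ℕ) : ℤ) • e μ := by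
  funext ν
  have hL0 : ((ℓ : ℤ) + 1) ^ j ≠ 0 := by positivity
  simp only [blk, Pi.add_apply, Pi.smul_apply, smul_eq_mul]
  rw [period_eq_pow_mul i hj μ]
  push_cast
  rw [show x ν + (((ℓ : ℤ) + 1) ^ j * (qLev i j μ : ℤ)) * e μ ν = x ν + (((ℓ : ℤ) + 1) ^ j) * ((qLev i j μ : ℤ) * e μ ν) by ring,
    Int.add_mul_ediv_left _ _ hL0]

/-- ★★ **`Q′(U)Λ = 0 ⟹` the knit's level-`n` average of `Λ♯` VANISHES AT EVERY LABEL of `ℤ^{d+1}`** (constant-level member: the labels of the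
member's blocks exhaust the coarse torus, and the average of periodic data is periodic in the label — J-B file 4a).
[cite: Balaban1985BackgroundPropagators, (3.19) p.393, (3.21) p.394; Balaban1985RegularSpaces, (1.29) p.81, p.77 («Ω_j = T_η»)] -/
theorem QprimeIter_liftL_eq_zero (hlev : ∀ z : SiteY i, levY i z = n) (U : CfgY 𝔸 i) {Λ : SiteY i → 𝔸} (hΛ : QpY i (parKnitY i) U Λ = 0)
    (y : LSite (d + 1)) : QprimeIter (zdBlocking (d + 1) (ℓ + 1)) (bgT (ℓ + 1) (liftCfg U)) n (liftL i Λ) y = 0 := by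
  have hn : n ≤ i.k := constLev_le i hlev
  have hper : ∀ μ, shiftCfg ((((PV d ℓ i.m i.K hd hL).sitesPerDir 0 : ℕ) : ℤ) • e μ) (liftL i Λ) = liftL i Λ := fun μ => by
    rw [liftL_eq]; exact shiftCfg_liftFun (P := PV d ℓ i.m i.K hd hL) _ μ
  -- the average read at the label of a fine point is a periodic function of the fine point
  let F : LSite (d + 1) → 𝔸 := fun x => QprimeIter (zdBlocking (d + 1) (ℓ + 1)) (bgT (ℓ + 1) (liftCfg U)) n (liftL i Λ) (blk ((ℓ + 1) ^ n) x)
  have hF : ∀ (x : LSite (d + 1)) (μ : Fin (d + 1)), F (x + (((PV d ℓ i.m i.K hd hL).sitesPerDir 0 : ℕ) : ℤ) • e μ) = F x := by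
    intro x μ
    simp only [F]
    rw [blk_add_period i hn x μ, QprimeIter_periodic i U hper hn]
  have hL1 : 1 ≤ (ℓ + 1) ^ n := Nat.one_le_pow _ _ (Nat.succ_le_succ (Nat.zero_le ℓ))
  have hy : F ((((ℓ + 1) ^ n : ℕ) : ℤ) • y) = QprimeIter (zdBlocking (d + 1) (ℓ + 1)) (bgT (ℓ + 1) (liftCfg U)) n (liftL i Λ) y := by
    simp only [F]; rw [blk_smul_self hL1]
  rw [← hy, periodic_eq_at_chart i hF]
  show QprimeIter (zdBlocking (d + 1) (ℓ + 1)) (bgT (ℓ + 1) (liftCfg U)) n (liftL i Λ)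
      (blk ((ℓ + 1) ^ n) (siteAt i ((((ℓ + 1) ^ n : ℕ) : ℤ) • y)).1) = 0
  have hz := QprimeIter_liftL_at_blk_eq_zero i U hΛ (siteAt i ((((ℓ + 1) ^ n : ℕ) : ℤ) • y))
  rwa [hlev] at hz

end Knit

/-! ## §3 At `𝔸 = M_N(ℂ)`: `f − R f ⊥ Δ_U N(Q′)` for the trace pairing, and `R f` is Hermitian-valued for Hermitian `f` -/

section Ortho

open scoped Matrix Matrix.Norms.L2Operator

variable {N : ℕ} (i : KIdx d ℓ hd hL b₀ b₁) {G : Subgroup (Matrix (Fin N) (Fin N) ℂ)ˣ}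

omit hd hL b₀ b₁ i in
/-- the trace pairing with a zero left argument vanishes. [cite: Balaban1985BackgroundPropagators, p.393 (scalar products), bookkeeping] -/
theorem trIP_zero_left {S : Type} [Fintype S] (w : S → ℝ) (Ψ : S → Matrix (Fin N) (Fin N) ℂ) : trIP w 0 Ψ = 0 := by
  simp [trIP]

/-- ★★ **`f − R(U)f ⊥ Δ′_a(U) N(Q′(U)) = Δ_U N(Q′(U))`** for the trace pairing — the ORTHOGONALITY half of «R is an orthogonal projection onto
Δ^η_U N(Q′)» (3.21), at the knit's transporters `parKnitY` and `G`-valued data, `G ≤ U(N)`: by the symmetry of `Δ′_a(U)` (n06-j ∕ p33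
`deltaPrimeAY_isSymmTr_of_inv_symm` + `parKnitY_inv`), `Δ′_a G′ = 1`, and «Q′* is the adjoint of Q′» (`isAdjTr_QpY_QpsY`):
`⟨Δ′_aλ, G′Q′*μ⟩ = ⟨λ, Q′*μ⟩ = ⟨Q′λ, μ⟩_𝔅 = 0`. [cite: Balaban1985BackgroundPropagators, (3.21)–(3.25) pp.394–395, p.392 («The adjoints are taken with respect to natural L² scalar products»)] -/
theorem trIP_lapS_sub_RY_eq_zero (hG : G ≤ B7Prop2Explicit.unitaryUnits (Matrix (Fin N) (Fin N) ℂ)) {U : CfgY (Matrix (Fin N) (Fin N) ℂ) i}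
    (hU : ∀ μ x, U μ x ∈ G) (hpar : ∀ z w : SiteY i, parKnitY i U z w ∈ G) (hΔ : IsUnit (deltaPrimeAY i (parKnitY i) U))
    {Λ : SiteY i → Matrix (Fin N) (Fin N) ℂ} (hΛ : QpY i (parKnitY i) U Λ = 0) (f : SiteY i → Matrix (Fin N) (Fin N) ℂ) :
    trIP (fun _ => (1 : ℝ)) (lapS i U Λ) (f - RY i (parKnitY i) (GpY i (parKnitY i)) U f) = 0 := by
  rw [← deltaPrimeAY_parKnitY_eq_lapS_of_QpY_eq_zero i U hΛ, sub_RY_apply i (parKnitY i) U f]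
  have hsymm : IsSymmTr (fun _ => (1 : ℝ)) (deltaPrimeAY i (parKnitY i) U) :=
    deltaPrimeAY_isSymmTr_of_inv_symm i hG (parKnitY i) U (parKnitY_inv i U) hpar hU
  have hΔG : ∀ v : SiteY i → Matrix (Fin N) (Fin N) ℂ, deltaPrimeAY i (parKnitY i) U (GpY i (parKnitY i) U v) = v := fun v => by
    have h := congrArg (fun T : Module.End ℂ (SiteY i → Matrix (Fin N) (Fin N) ℂ) => T v) (deltaPrimeAY_mul_GpY i (parKnitY i) U hΔ)
    simpa only [Module.End.mul_apply, Module.End.one_apply] using h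
  have hadj : IsAdjTr (fun _ => (1 : ℝ)) (wB i) (QpY i (parKnitY i) U) (QpsY i (parKnitY i) U) :=
    isAdjTr_QpY_QpsY i (parKnitY i) U fun s z => parKnitY_mem_unitary i hG hpar _ _
  rw [hsymm, hΔG, ← hadj, hΛ]
  exact trIP_zero_left _ _

/-- ★ `R(U)f` is Hermitian-valued for Hermitian-valued `f` (def-Y's `RY_isRealOpY` by name). [cite: Balaban1985BackgroundPropagators, (3.25) p.395, p.391 («functions with values in N × N hermitian matrices»)] -/
theorem isSelfAdjoint_RY_apply (hG : G ≤ B7Prop2Explicit.unitaryUnits (Matrix (Fin N) (Fin N) ℂ)) {U : CfgY (Matrix (Fin N) (Fin N) ℂ) i}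
    (hU : ∀ μ x, U μ x ∈ G) (hpar : ∀ z w : SiteY i, parKnitY i U z w ∈ G) {f : SiteY i → Matrix (Fin N) (Fin N) ℂ}
    (hf : ∀ z, IsSelfAdjoint (f z)) (z : SiteY i) : IsSelfAdjoint (RY i (parKnitY i) (GpY i (parKnitY i)) U f z) :=
  isSelfAdjoint_apply_of_isRealOpY
    (RY_isRealOpY i U (parKnitY i) (GpY i (parKnitY i)) (parKnitY_mem_unitary i hG hpar) (GpY_parKnitY_isRealOpY i hG hU hpar)) hf z

/-- ★ the Lagrange minimiser `λ₀ = G′f − G′²Q′*μ` is Hermitian-valued for Hermitian-valued `f`. [cite: Balaban1985BackgroundPropagators, (3.22) p.394, p.391] -/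
theorem isSelfAdjoint_lagrange_apply (hG : G ≤ B7Prop2Explicit.unitaryUnits (Matrix (Fin N) (Fin N) ℂ)) {U : CfgY (Matrix (Fin N) (Fin N) ℂ) i}
    (hU : ∀ μ x, U μ x ∈ G) (hpar : ∀ z w : SiteY i, parKnitY i U z w ∈ G) {f : SiteY i → Matrix (Fin N) (Fin N) ℂ}
    (hf : ∀ z, IsSelfAdjoint (f z)) (z : SiteY i) :
    IsSelfAdjoint
      ((GpY i (parKnitY i) U f -
        GpY i (parKnitY i) U (GpY i (parKnitY i) U (QpsY i (parKnitY i) U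
          (XinvY i (parKnitY i) (GpY i (parKnitY i)) U (QpY i (parKnitY i) U (GpY i (parKnitY i) U f)))))) z) := by
  have hS := parKnitY_mem_unitary i hG hpar
  have hGp : IsRealOpY (GpY i (parKnitY i) U) := GpY_parKnitY_isRealOpY i hG hU hpar
  have hT : IsRealOpY (GpY i (parKnitY i) U -
      GpY i (parKnitY i) U ∘ₗ GpY i (parKnitY i) U ∘ₗ QpsY i (parKnitY i) U ∘ₗ XinvY i (parKnitY i) (GpY i (parKnitY i)) U ∘ₗ
        QpY i (parKnitY i) U ∘ₗ GpY i (parKnitY i) U) :=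
    hGp.sub (hGp.comp (hGp.comp ((QpsY_isRealOpY i U (parKnitY i) hS).comp
      ((XinvY_isRealOpY i U (parKnitY i) (GpY i (parKnitY i)) hS hGp).comp ((QpY_isRealOpY i U (parKnitY i) hS).comp hGp)))))
  have h := isSelfAdjoint_apply_of_isRealOpY hT hf z
  simpa only [LinearMap.sub_apply, LinearMap.coe_comp, Function.comp_apply] using h

end Ortho

/-! ## §4 The junction: dag-n06's periodic orthogonal projection `projRPer` (3.21) IS def-Y's `RY` (3.25) at the torus datum -/

section Junction

open scoped Matrix Matrix.Norms.L2Operator ComplexOrder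
open T4TermwiseTorus (IsPeriodic box mem_box)
open B9Eq321LandauProjectionZdPer (perSub perRestrict perRestrict_eq_self perRestrict_mem_perSub formPer formPer_apply gaugeNullPer rangeGenPer
  rangeSubPer projEPer projRPer projEPer_apply_of_mem_orthogonal projEPer_apply_of_mem_range)

variable (i : KIdx d ℓ hd hL b₀ b₁) {n : ℕ}

/-! ### §4.1 Periodicity bookkeeping and the period-cell sum on the two carriers -/

omit hd hL b₀ b₁ i in
/-- a `P`-periodic function (all lattice translates) is periodic in every coordinate direction. [cite: Balaban1985RegularSpaces, (1.3) p.77, bookkeeping] -/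
theorem apply_add_period_of_isPeriodic {β : Type*} {P : ℕ} {F : LSite (d + 1) → β} (hF : IsPeriodic P F) (x : LSite (d + 1)) (μ : Fin (d + 1)) :
    F (x + ((P : ℕ) : ℤ) • e μ) = F x :=
  hF x (e μ)

omit hd hL b₀ b₁ i in
/-- the same in the `shiftCfg` currency of the junction files. [cite: Balaban1985RegularSpaces, (1.3) p.77, bookkeeping] -/
theorem shiftCfg_eq_of_isPeriodic {β : Type*} {P : ℕ} {F : LSite (d + 1) → β} (hF : IsPeriodic P F) (μ : Fin (d + 1)) :
    shiftCfg (((P : ℕ) : ℤ) • e μ) F = F :=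
  funext fun x => hF x (e μ)

/-- translating the origin of the member's torus by a period multiple does nothing. [cite: Balaban1985RegularSpaces, (1.3) p.77, bookkeeping] -/
theorem transl_add_period_smul (x m : LSite (d + 1)) :
    B10Eq27TorusAxialLog.transl (0 : Site (PV d ℓ i.m i.K hd hL) 0) (x + (((PV d ℓ i.m i.K hd hL).sitesPerDir 0 : ℕ) : ℤ) • m) =
      B10Eq27TorusAxialLog.transl (0 : Site (PV d ℓ i.m i.K hd hL) 0) x := by
  funext ν
  simp [B10Eq27TorusAxialLog.transl_apply, Pi.add_apply, Int.cast_mul, Int.cast_natCast]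

variable {𝔸 : Type} [NormedRing 𝔸] [NormedAlgebra ℂ 𝔸] [CompleteSpace 𝔸] in
omit [CompleteSpace 𝔸] in
/-- ★ the periodic extension `Φ♯ = liftL Φ` of a box function is `N₀`-PERIODIC in dag-n06's full-lattice sense. [cite: Balaban1985RegularSpaces, (1.3) p.77, p.77 («Ω_j = T_η»)] -/
theorem liftL_isPeriodic (Φ : SiteY i → 𝔸) : IsPeriodic ((PV d ℓ i.m i.K hd hL).sitesPerDir 0) (liftL i Φ) := fun x m => by
  rw [liftL_apply, liftL_apply, B9B8KnitLetterTransfer.siteAt_eq, B9B8KnitLetterTransfer.siteAt_eq, transl_add_period_smul]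

/-- the chart point of a cell point is the point itself. [cite: Balaban1984PropagatorsII, (2.1) p.224, bookkeeping] -/
theorem siteAt_val_of_mem_box {x : LSite (d + 1)} (hx : x ∈ box ((PV d ℓ i.m i.K hd hL).sitesPerDir 0)) : (siteAt i x).1 = x := by
  funext μ
  rw [siteAt_val_apply]
  obtain ⟨h0, h1⟩ := (mem_box.1 hx) μ
  exact Int.emod_eq_of_lt h0 h1

/-- every box point lies in dag-n06's period cell `[0, N₀)^{d+1}`. [cite: Balaban1984PropagatorsII, (2.1) p.224, bookkeeping] -/
theorem val_mem_box (z : SiteY i) : z.1 ∈ box ((PV d ℓ i.m i.K hd hL).sitesPerDir 0) := by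
  rw [mem_box]
  intro κ
  have hP : (0 : ℤ) < (((PV d ℓ i.m i.K hd hL).sitesPerDir 0 : ℕ) : ℤ) := by
    exact_mod_cast Nat.pos_of_ne_zero (Params.sitesPerDir_ne_zero _ 0)
  have h : z.1 κ = z.1 κ % (((PV d ℓ i.m i.K hd hL).sitesPerDir 0 : ℕ) : ℤ) := by
    have h1 := siteAt_val_apply i z.1 κ
    rwa [siteAt_of_mem i z] at h1
  rw [h]
  exact ⟨Int.emod_nonneg _ hP.ne', Int.emod_lt_of_pos _ hP⟩

/-- ★ **THE PERIOD-CELL SUM ON THE TWO CARRIERS**: `Σ_{x ∈ [0,N₀)^{d+1}} F(x) = Σ_{z ∈ box} F(z)` (the chart is a bijection of the cell onto the box).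
[cite: Balaban1985BackgroundPropagators, (3.17) p.393 (the sum over the torus); Balaban1984PropagatorsII, (2.1) p.224] -/
theorem sum_box_eq_sum_siteY {M : Type*} [AddCommMonoid M] (F : LSite (d + 1) → M) :
    ∑ x ∈ box ((PV d ℓ i.m i.K hd hL).sitesPerDir 0), F x = ∑ z : SiteY i, F z.1 :=
  Finset.sum_nbij' (fun x => siteAt i x) (fun z => z.1) (fun _ _ => Finset.mem_univ _) (fun z _ => val_mem_box i z)
    (fun x hx => siteAt_val_of_mem_box i hx) (fun z _ => siteAt_of_mem i z) (fun x hx => by rw [siteAt_val_of_mem_box i hx])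

/-! ### §4.2 The trace datum `τ = tr` on `M_N(ℂ)` -/

variable {N : ℕ}

omit hd hL b₀ b₁ i in
/-- `tr(a*) = conj tr(a)`. [cite: Balaban1985BackgroundPropagators, p.391 («X·Y = tr XY»), bookkeeping] -/
theorem trace_hermitian (τ : Matrix (Fin N) (Fin N) ℂ →ₗ[ℂ] ℂ) (hτ : ∀ a, τ a = Matrix.trace a) (a : Matrix (Fin N) (Fin N) ℂ) :
    τ (star a) = starRingEnd ℂ (τ a) := by
  rw [hτ, hτ, Matrix.star_eq_conjTranspose, Matrix.trace_conjTranspose, starRingEnd_apply]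

omit hd hL b₀ b₁ i in
/-- `Re tr(a*a) > 0` for `a ≠ 0` (the trace pairing is faithful). [cite: Balaban1985BackgroundPropagators, p.391, bookkeeping] -/
theorem trace_faithful (τ : Matrix (Fin N) (Fin N) ℂ →ₗ[ℂ] ℂ) (hτ : ∀ a, τ a = Matrix.trace a) (a : Matrix (Fin N) (Fin N) ℂ) (ha : a ≠ 0) :
    0 < (τ (star a * a)).re := by
  rw [hτ, Matrix.star_eq_conjTranspose]
  have hnn := (Matrix.posSemidef_conjTranspose_mul_self a).trace_nonneg
  obtain ⟨hre, him⟩ := Complex.nonneg_iff.mp hnn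
  rcases hre.lt_or_eq with h | h
  · exact h
  · exfalso
    have h0 : Matrix.trace (aᴴ * a) = 0 := Complex.ext h.symm him.symm
    exact ha (Matrix.trace_conjTranspose_mul_self_eq_zero_iff.mp h0)

/-- ★ **dag-n06's torus pairing IS the trace pairing of the N06 row-17 files** read through the chart: `formPer tr N₀ f g = ⟨f♭, g♭⟩₁`.
[cite: Balaban1985BackgroundPropagators, p.393 (scalar products), (3.21) p.394] -/
theorem formPer_eq_trIP (τ : Matrix (Fin N) (Fin N) ℂ →ₗ[ℂ] ℂ) (hτ : ∀ a, τ a = Matrix.trace a) :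
    letI : CStarAlgebra (Matrix (Fin N) (Fin N) ℂ) := {}
    ∀ f g : perSub (𝔸 := Matrix (Fin N) (Fin N) ℂ) (d := d + 1) ((PV d ℓ i.m i.K hd hL).sitesPerDir 0),
      formPer τ ((PV d ℓ i.m i.K hd hL).sitesPerDir 0) f g =
        trIP (fun _ => (1 : ℝ)) (descL i (f : LSite (d + 1) → Matrix (Fin N) (Fin N) ℂ)) (descL i (g : LSite (d + 1) → Matrix (Fin N) (Fin N) ℂ)) := by
  letI : CStarAlgebra (Matrix (Fin N) (Fin N) ℂ) := {}
  intro f g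
  rw [formPer_apply, trIP_eq_re_trace, sum_box_eq_sum_siteY i]
  refine Finset.sum_congr rfl fun z _ => ?_
  rw [one_mul, hτ, descL_apply, descL_apply, Matrix.star_eq_conjTranspose]

omit hd hL b₀ b₁ i in
/-- the trace pairing is real-homogeneous in its first argument. [cite: Balaban1985BackgroundPropagators, p.393 (scalar products), bookkeeping] -/
theorem trIP_real_smul_left {S : Type} [Fintype S] (w : S → ℝ) (c : ℝ) (Φ Ψ : S → Matrix (Fin N) (Fin N) ℂ) :
    trIP w (c • Φ) Ψ = c * trIP w Φ Ψ := by
  rw [trIP_eq_re_trace, trIP_eq_re_trace, Finset.mul_sum]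
  refine Finset.sum_congr rfl fun s _ => ?_
  rw [Pi.smul_apply, Matrix.conjTranspose_smul, star_trivial, Matrix.smul_mul, Matrix.trace_smul, Complex.smul_re, smul_eq_mul]
  ring

/-! ### §4.3 The theorem -/

/-- ★★★ **[4] (3.21) = (3.25) ON THE TORUS, ACROSS THE TWO LINEAGES.**  At a constant-level member of the catalogue (`levY ≡ n`), for a
`G`-valued (`G ≤ U(N)`) `N₀`-periodic background `U₀` with `G`-valued knit legs, in the regime where `Δ′_a(U)` and `Q′G′²Q′*` are invertible
at the knit's transporters, and `η ≠ 0`: for every `N₀`-PERIODIC HERMITIAN-VALUED site function `f` on `ℤ^{d+1}`, dag-n06's ORTHOGONAL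
PROJECTION (3.21)–(3.22) onto `Δ^η_{U₀}N_𝔤^per(Q′(U₀))` for the trace pairing — `projRPer tr N₀ L n η (torusLam n) U₀ f` — EQUALS the periodic
extension of def-Y's LAGRANGE-MULTIPLIER FORMULA (3.25) `R(U) = I − G′Q′*(Q′G′²Q′*)⁻¹Q′G′` applied to `f♭`, at `parS := parKnitY`,
`G′ := GpY parKnitY`, `U := bgY U₀`.  Print p. 394: «Using the Lagrange multipliers method the minimum of (3.22) can be found … and we obtain
the formula (3.25)» — here: `Rf = Δ′_aλ₀ = Δ_Uλ₀` with `Q′λ₀ = 0` lies in the range (§§1–2, J-B by name), and `f − Rf = G′Q′*μ` is orthogonal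
to it (§3); dag-n06's projection is characterised by exactly these two facts (`projEPer_apply_of_mem_range ∕ _of_mem_orthogonal`).
OUR READING (not print's): the trace datum is `τ = tr` (print: «X·Y = tr XY», p. 391); the knit's transporters are p33's `parKnitY`.
[cite: Balaban1985BackgroundPropagators, (3.21)–(3.25) pp.394–395, p.391, p.392 («The adjoints are taken with respect to natural L² scalar products»); Balaban1985RegularSpaces, p.77 («Ω_j = T_η»), (1.58) p.86] -/
theorem projRPer_eq_liftL_RY (hlev : ∀ z : SiteY i, levY i z = n) {G : Subgroup (Matrix (Fin N) (Fin N) ℂ)ˣ}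
    (hG : G ≤ B7Prop2Explicit.unitaryUnits (Matrix (Fin N) (Fin N) ℂ))
    {U₀ : LSite (d + 1) → Fin (d + 1) → (Matrix (Fin N) (Fin N) ℂ)ˣ} (hU₀G : ∀ x μ, U₀ x μ ∈ G)
    (hU₀per : IsPeriodic ((PV d ℓ i.m i.K hd hL).sitesPerDir 0) U₀)
    (hpar : ∀ z w : SiteY i, parKnitY i (bgY i U₀) z w ∈ G)
    (hΔ : IsUnit (deltaPrimeAY i (parKnitY i) (bgY i U₀))) (hX : IsUnit (XY i (parKnitY i) (GpY i (parKnitY i)) (bgY i U₀)))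
    {η : ℝ} (hη : η ≠ 0) (τ : Matrix (Fin N) (Fin N) ℂ →ₗ[ℂ] ℂ) (hτ : ∀ a, τ a = Matrix.trace a)
    {f : LSite (d + 1) → Matrix (Fin N) (Fin N) ℂ} (hfper : IsPeriodic ((PV d ℓ i.m i.K hd hL).sitesPerDir 0) f)
    (hfh : ∀ x, IsSelfAdjoint (f x)) :
    letI : CStarAlgebra (Matrix (Fin N) (Fin N) ℂ) := {}
    projRPer τ ((PV d ℓ i.m i.K hd hL).sitesPerDir 0) (ℓ + 1) n η (torusLam (d := d + 1) n) U₀ f =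
      liftL i (RY i (parKnitY i) (GpY i (parKnitY i)) (bgY i U₀) (descL i f)) := by
  letI : CStarAlgebra (Matrix (Fin N) (Fin N) ℂ) := {}
  -- the data
  have hU : ∀ μ x, bgY i U₀ μ x ∈ G := bgY_mem i hU₀G
  have hU₀sh : ∀ μ, shiftCfg ((((PV d ℓ i.m i.K hd hL).sitesPerDir 0 : ℕ) : ℤ) • e μ) U₀ = U₀ := fun μ => shiftCfg_eq_of_isPeriodic hU₀per μ
  have hlift : liftCfg (bgY i U₀) = U₀ := liftCfg_bgY i hU₀sh
  have hτs := trace_hermitian τ hτ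
  have hτp := trace_faithful τ hτ
  set U := bgY i U₀
  set fb : SiteY i → Matrix (Fin N) (Fin N) ℂ := descL i f with hfb
  set gb : SiteY i → Matrix (Fin N) (Fin N) ℂ := RY i (parKnitY i) (GpY i (parKnitY i)) U fb with hgb
  set g : LSite (d + 1) → Matrix (Fin N) (Fin N) ℂ := liftL i gb with hg
  -- the Lagrange minimiser and its properties (§§1–3)
  set lam0 : SiteY i → Matrix (Fin N) (Fin N) ℂ := GpY i (parKnitY i) U fb -
      GpY i (parKnitY i) U (GpY i (parKnitY i) U (QpsY i (parKnitY i) U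
        (XinvY i (parKnitY i) (GpY i (parKnitY i)) U (QpY i (parKnitY i) U (GpY i (parKnitY i) U fb)))))
  have hQ : QpY i (parKnitY i) U lam0 = 0 := QpY_lagrange_eq_zero i (parKnitY i) U hX fb
  have hgb' : gb = lapS i U lam0 := by
    rw [hgb, RY_apply_eq_deltaPrimeAY i (parKnitY i) U hΔ fb]
    exact deltaPrimeAY_parKnitY_eq_lapS_of_QpY_eq_zero i U hQ
  have hfbh : ∀ z, IsSelfAdjoint (fb z) := fun z => hfh z.1
  have hlam0h : ∀ x, IsSelfAdjoint (liftL i lam0 x) := fun x => by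
    rw [liftL_apply]; exact isSelfAdjoint_lagrange_apply i hG hU hpar hfbh _
  -- periodicity
  have hgper : IsPeriodic ((PV d ℓ i.m i.K hd hL).sitesPerDir 0) g := liftL_isPeriodic i gb
  have hhper : IsPeriodic ((PV d ℓ i.m i.K hd hL).sitesPerDir 0) (f - g) := fun x m => by
    simp only [Pi.sub_apply]; rw [hfper x m, hgper x m]
  -- g = (η²) • Δ^η_{U₀}(λ₀♯)
  have hlamsh : ∀ μ, shiftCfg ((((PV d ℓ i.m i.K hd hL).sitesPerDir 0 : ℕ) : ℤ) • e μ) (liftL i lam0) = liftL i lam0 := fun μ =>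
    shiftCfg_eq_of_isPeriodic (liftL_isPeriodic i lam0) μ
  have hgfun : g = fun x => (η * η : ℝ) • covLap η U₀ (liftL i lam0) x := by
    funext x
    have hcov : covLap η U₀ (liftL i lam0) x = covLap η U₀ (liftL i lam0) (siteAt i x).1 := by
      have hp : ∀ (y : LSite (d + 1)) (μ : Fin (d + 1)),
          covLap η U₀ (liftL i lam0) (y + (((PV d ℓ i.m i.K hd hL).sitesPerDir 0 : ℕ) : ℤ) • e μ) = covLap η U₀ (liftL i lam0) y := by
        intro y μ
        have h := covLap_periodic i η U hlamsh y μ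
        rwa [hlift] at h
      exact periodic_eq_at_chart i hp x
    rw [hg, liftL_apply, hgb', lapS_eq_covLap_liftL i η U hη lam0 (siteAt i x), hlift, ← hcov, Complex.coe_smul]
  -- (1) g lies in the range
  have hη2 : (η * η : ℝ) ≠ 0 := mul_ne_zero hη hη
  have hcovper : IsPeriodic ((PV d ℓ i.m i.K hd hL).sitesPerDir 0) (covLap η U₀ (liftL i lam0)) := fun x m => by
    have h3 : g (x + (((PV d ℓ i.m i.K hd hL).sitesPerDir 0 : ℕ) : ℤ) • m) = g x := hgper x m
    rw [hgfun] at h3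
    exact smul_right_injective _ hη2 h3
  set wgen : perSub (𝔸 := Matrix (Fin N) (Fin N) ℂ) (d := d + 1) ((PV d ℓ i.m i.K hd hL).sitesPerDir 0) :=
    ⟨covLap η U₀ (liftL i lam0), hcovper⟩
  have hgen : wgen ∈ rangeGenPer ((PV d ℓ i.m i.K hd hL).sitesPerDir 0) (ℓ + 1) n η (torusLam (d := d + 1) n) U₀ := by
    refine ⟨liftL i lam0, ⟨hlam0h, liftL_isPeriodic i lam0, fun j hj y hy => ?_⟩, rfl⟩
    have hjn : j = n := (B8Thm4TorusAt.mem_torusLam_iff n j y).1 hy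
    subst hjn
    have h := QprimeIter_liftL_eq_zero i hlev U hQ y
    rwa [hlift] at h
  have hg_mem : (⟨g, hgper⟩ : perSub (𝔸 := Matrix (Fin N) (Fin N) ℂ) (d := d + 1) ((PV d ℓ i.m i.K hd hL).sitesPerDir 0)) ∈
      rangeSubPer ((PV d ℓ i.m i.K hd hL).sitesPerDir 0) (ℓ + 1) n η (torusLam (d := d + 1) n) U₀ := by
    have hsm : (⟨g, hgper⟩ : perSub (𝔸 := Matrix (Fin N) (Fin N) ℂ) (d := d + 1) ((PV d ℓ i.m i.K hd hL).sitesPerDir 0)) =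
        (η * η : ℝ) • wgen := Subtype.ext hgfun
    rw [hsm]
    exact Submodule.smul_mem _ _ (Submodule.subset_span hgen)
  -- (2) f − g is orthogonal to the range
  have hh_mem : (⟨f - g, hhper⟩ : perSub (𝔸 := Matrix (Fin N) (Fin N) ℂ) (d := d + 1) ((PV d ℓ i.m i.K hd hL).sitesPerDir 0)) ∈
      (formPer τ ((PV d ℓ i.m i.K hd hL).sitesPerDir 0)).orthogonal
        (rangeSubPer ((PV d ℓ i.m i.K hd hL).sitesPerDir 0) (ℓ + 1) n η (torusLam (d := d + 1) n) U₀) := by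
    rw [LinearMap.BilinForm.mem_orthogonal_iff]
    intro w hw
    refine Submodule.span_induction (p := fun w _ => formPer τ ((PV d ℓ i.m i.K hd hL).sitesPerDir 0) w ⟨f - g, hhper⟩ = 0)
      ?_ ?_ ?_ ?_ hw
    · rintro w ⟨lam, hlam, hwlam⟩
      rw [formPer_eq_trIP i τ hτ]
      -- the generator on the box: `(Δλ)♭ = (η²)⁻¹ • Δ_U λ♭`, `λ♭` in the null space of `Q′(U)`
      have hlamdir : ∀ (x : LSite (d + 1)) (μ : Fin (d + 1)), lam (x + (((PV d ℓ i.m i.K hd hL).sitesPerDir 0 : ℕ) : ℤ) • e μ) = lam x :=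
        fun x μ => hlam.2.1 x (e μ)
      have hQlam : QpY i (parKnitY i) U (descL i lam) = 0 := by
        funext s
        have hs : s.1.1 = n := blk_level i hlev s
        rw [QpY_parKnitY_eq_QprimeIter, ← liftL_eq, liftL_descL i hlamdir, hlift, hs]
        exact hlam.2.2 n le_rfl s.1.2 ((B8Thm4TorusAt.mem_torusLam_iff n n s.1.2).2 rfl)
      have hwb : descL i (w : LSite (d + 1) → Matrix (Fin N) (Fin N) ℂ) = ((η * η)⁻¹ : ℝ) • lapS i U (descL i lam) := by
        funext z
        rw [descL_apply, hwlam, Pi.smul_apply, lapS_eq_covLap_liftL i η U hη (descL i lam) z, liftL_descL i hlamdir, hlift,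
          ← Complex.coe_smul (η * η)⁻¹, smul_smul, ← Complex.ofReal_mul, inv_mul_cancel₀ (mul_ne_zero hη hη), Complex.ofReal_one, one_smul]
      have hfg : descL i (f - g) = fb - RY i (parKnitY i) (GpY i (parKnitY i)) U fb := by
        rw [map_sub, ← hfb, hg, descL_liftL]
      rw [hwb, hfg, trIP_real_smul_left, trIP_lapS_sub_RY_eq_zero i hG hU hpar hΔ hQlam fb, mul_zero]
    · rw [map_zero, LinearMap.zero_apply]
    · intro x y _ _ hx hy
      rw [map_add, LinearMap.add_apply, hx, hy, add_zero]
    · intro r x _ hx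
      rw [map_smul, LinearMap.smul_apply, hx, smul_zero]
  -- (3) conclusion
  have hsplit : (⟨f, hfper⟩ : perSub (𝔸 := Matrix (Fin N) (Fin N) ℂ) (d := d + 1) ((PV d ℓ i.m i.K hd hL).sitesPerDir 0)) =
      ⟨g, hgper⟩ + ⟨f - g, hhper⟩ := Subtype.ext (by simp)
  have hproj : projEPer τ ((PV d ℓ i.m i.K hd hL).sitesPerDir 0) (ℓ + 1) n η (torusLam (d := d + 1) n) U₀ ⟨f, hfper⟩ = ⟨g, hgper⟩ := by
    rw [hsplit, map_add, projEPer_apply_of_mem_range (ℓ + 1) n η _ U₀ hτs hτp hg_mem,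
      projEPer_apply_of_mem_orthogonal (ℓ + 1) n η _ U₀ hτs hτp hh_mem, add_zero]
  have hres : (⟨perRestrict ((PV d ℓ i.m i.K hd hL).sitesPerDir 0) f, perRestrict_mem_perSub _ f⟩ :
      perSub (𝔸 := Matrix (Fin N) (Fin N) ℂ) (d := d + 1) ((PV d ℓ i.m i.K hd hL).sitesPerDir 0)) = ⟨f, hfper⟩ :=
    Subtype.ext (perRestrict_eq_self _ hfper)
  show ((projEPer τ ((PV d ℓ i.m i.K hd hL).sitesPerDir 0) (ℓ + 1) n η (torusLam (d := d + 1) n) U₀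
      ⟨perRestrict ((PV d ℓ i.m i.K hd hL).sitesPerDir 0) f, perRestrict_mem_perSub _ f⟩ :
        perSub (𝔸 := Matrix (Fin N) (Fin N) ℂ) (d := d + 1) ((PV d ℓ i.m i.K hd hL).sitesPerDir 0)) : LSite (d + 1) → Matrix (Fin N) (Fin N) ℂ) = g
  rw [hres, hproj]

end Junction

end Literature.MathematicalPhysics.QuantumFieldTheory.Balaban1983to89.B9B8KnitLandauProjection
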